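import Literature.Probability.Percolation.MarkedLoopTripodBasis
import Literature.Probability.Percolation.MarkedLoopRotation
import HarnessLib

/-!
# The tripod law at seven marks: thirty-five patterns, fourteen outermost, fourteen free values («TRIPOD-SOLVED-SEVEN»)

The `k = 7` companion of `MarkedLoopTripodBasisFive.lean` (`k = 5`: ten patterns, five outermost, the five rotated fans a basis).
Khristoforov–Smirnov [KhS21, §1.2 and §2 Lemma 4] work with THREE disorders (`k = 3` corners: three link patterns, the weight `τ^j`);
the statements below are the lane's, inside the tree's generic framework `MarkedLoopTripodBasis.lean` (patterns `Pat k`, outermost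
patterns `Pat₀ k`, the solution space `solW k` of the tripod law, ★ `finrank_solW : finrank (solW k) = #Pat₀ k`, `solWEquiv`, `basisW`,
`pat₀EquivNCMatching`). Here everything generic is EVALUATED at seven corners by a finite classification:

* `rel₇ j m` (`m : Fin 5`) — the five non-crossing perfect matchings of the six corners `j+1, …, j+6`; `isPattern_rel₇`;
  ★ `relation_seven` — THE PATTERNS OF SEVEN CORNERS: the relation of a pattern with partner `j` is one of the five (partner chasing:
  the partner of `j+1` is `j+2`, `j+4` or `j+6` — `j+3`, `j+5` would cut off an odd set — and then one or two further forced choices;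
  crossings are excluded by `IsPattern.planar` on explicit `CcwQuad` quadruples); `card_pat_seven : #Pat 7 = 35`.
* `depth_seven` — the depth table: `(j; rel₇ j m)` is outermost iff `j ∈ {0, 6}`, or `j = 2, m ∈ {0, 2}`, or `j = 4, m ∈ {0, 1}`;
  `outer₇ : Fin 14 → Pat₀ 7` (tables `outerJ₇`, `outerM₇`), `outer₇_injective`, ★★ `pat₀_seven` — THE OUTERMOST PATTERNS ARE
  EXACTLY FOURTEEN; `card_pat₀_seven : #Pat₀ 7 = 14`; ★★★ `finrank_solW_seven : finrank ℂ (solW 7) = 14`; ★ `card_ncMatching_eight :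
  #NCMatching 8 = 14` (the Catalan number `C₄`, via the tree's bijection); `card_pic_seven : #Pic 7 = 21` (the relations of the law).
* `outerEquiv₇ : Fin 14 ≃ Pat₀ 7`; ★★★ `solWEquiv₇ : solW 7 ≃ₗ[ℂ] (Fin 14 → ℂ)` — FOURTEEN FREE VALUES (a solution is its
  values at the outermost patterns); `basis₇ : Module.Basis (Fin 14) ℂ (solW 7)`, `coe_basis₇`;
  ★★★ `tripodLaw_seven_iff_exists_sum_basisW` — THE LAW AT SEVEN MARKS SOLVED:
  `TripodLaw wt ↔ ∃ g : Fin 14 → ℂ, restrictW wt = ∑ i, g i • basisW (outer₇ i)`; `exists_unique_solW_seven`.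
* the seven ROTATED FANS (`fanR₇ s = restrictW (rotW (rot 7 ^ s) (fanWt 3))`, `fanR₇_mem_solW`): `fanSupport₇` / `fanWt_three_rel₇` (the
  tree's fan weight lives on the four patterns `(0;{16,25,34}), (1;{14,23,56}), (2;{12,36,45}), (3;{16,25,34})`), `rel₇_translate`,
  ★ `fanR₇_pat₇` (the rotated fans evaluated on all patterns), ★★ `linearIndependent_fanR₇`, `finrank_span_fanR₇ = 7`,
  ★★ `span_fanR₇_ne_top` — AT SEVEN MARKS THE ROTATED FANS ARE INDEPENDENT BUT SPAN ONLY HALF OF THE SOLUTIONS (contrast: `fanBasis`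
  at five marks).

No percolation statement is made here (the five-point side is `MarkedLoopFanFivePoint.lean` at `k = 5`); the class-only solutions at
`k ≥ 5` are the constants (`MarkedLoopClassOnly.lean`, when in the tree).

References: [KhS21] M. Khristoforov, S. Smirnov, *Percolation and O(1) loop model*, arXiv:2111.15612v1 (2021), §1.2 (p. 2: loop
representation, link patterns, cyclic indexing), §2 Definition 3 and Lemma 4 with Fig. 3 (p. 4); [BR06] B. Bollobás, O. Riordan,
*Percolation*, CUP 2006, Ch. 7 (site percolation on the triangular lattice — context only). The statements are the lane's
(Khristoforov–Smirnov treat three disorders); locators point at the notions being generalised.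

Tree: `MarkedLoopTripodBasis.lean` (`IsPattern` with `symm/irrefl/off/perfect/planar`, `off₂`, `ne_of_mem`, `partner_eq`; `depth`; `Pat`,
`Pat₀`, `Pic`, `solW`, `finrank_solW`, `finrank_solW_add_card_pic`, `card_pat₀_eq_card_ncMatching`, `solWEquiv`, `solWBasis`, `coe_solWBasis`,
`basisW`, `basisW_mem_solW`, `eq_sum_basisW_of_mem_solW`, `tripodLaw_iff_restrict_mem_solW`, `CcwQuad`), `MarkedLoopRotation.lean` (`rot`,
`val_rot_pow`, `relMap`, `rotW`, `tripodLaw_rotW_fanWt`), `MarkedLoopHolomorphy.lean` (`fanWt`, `fanRel`). Tactics: `decide +kernel` for the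
finite tables over `Fin 7 × Fin 5` (membership, depth, injectivity), `fin_cases`, `rcases`, `add_left_cancel` + `decide` for offset clashes.
-/

open Finset

namespace Literature.Probability.Percolation.MarkedLoops

open Literature.Probability.Percolation.FivePoint (tau)

/-! ### The patterns of seven corners -/
section PatternsSeven

/-- the five non-crossing perfect matchings of the six corners `j+1, …, j+6` other than the partner `j`, as relations (both orientations):
`m = 0`: `{12,34,56}`, `1`: `{12,36,45}`, `2`: `{14,23,56}`, `3`: `{16,23,45}`, `4`: `{16,25,34}` (offsets from `j`).
[cite: KhristoforovSmirnov2021, §1.2 (arXiv v1 p. 2: link patterns)] -/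
def rel₇ (j : Fin 7) (m : Fin 5) : Finset (Fin 7 × Fin 7) :=
  match m with
  | 0 => {(j+1, j+2), (j+2, j+1), (j+3, j+4), (j+4, j+3), (j+5, j+6), (j+6, j+5)}
  | 1 => {(j+1, j+2), (j+2, j+1), (j+3, j+6), (j+6, j+3), (j+4, j+5), (j+5, j+4)}
  | 2 => {(j+1, j+4), (j+4, j+1), (j+2, j+3), (j+3, j+2), (j+5, j+6), (j+6, j+5)}
  | 3 => {(j+1, j+6), (j+6, j+1), (j+2, j+3), (j+3, j+2), (j+4, j+5), (j+5, j+4)}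
  | 4 => {(j+1, j+6), (j+6, j+1), (j+2, j+5), (j+5, j+2), (j+3, j+4), (j+4, j+3)}

/-- each `(j; rel₇ j m)` is a pattern. [cite: KhristoforovSmirnov2021, §1.2 (arXiv v1 p. 2)] -/
theorem isPattern_rel₇ (j : Fin 7) (m : Fin 5) : IsPattern j (rel₇ j m) := by
  have hs : ∀ (j : Fin 7) (m : Fin 5) (a b : Fin 7), (a, b) ∈ rel₇ j m → (b, a) ∈ rel₇ j m := by unfold rel₇; decide +kernel
  have hi : ∀ (j : Fin 7) (m : Fin 5) (a : Fin 7), (a, a) ∉ rel₇ j m := by unfold rel₇; decide +kernel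
  have ho : ∀ (j : Fin 7) (m : Fin 5) (a b : Fin 7), (a, b) ∈ rel₇ j m → a ≠ j := by unfold rel₇; decide +kernel
  have hp : ∀ (j : Fin 7) (m : Fin 5) (a : Fin 7), a ≠ j → ∃ b, (a, b) ∈ rel₇ j m ∧ ∀ b', (a, b') ∈ rel₇ j m → b' = b := by
    unfold rel₇; decide +kernel
  have hq : ∀ (j : Fin 7) (m : Fin 5) (x y z w : Fin 7), (x, z) ∈ rel₇ j m → (y, w) ∈ rel₇ j m → ¬ CcwQuad x y z w := by
    unfold rel₇ CcwQuad; decide +kernel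
  exact ⟨hs j m, hi j m, ho j m, fun a ha => by obtain ⟨b, hb, hu⟩ := hp j m a ha; exact ⟨b, hb, hu⟩, hq j m⟩

/-- ★ **THE PATTERNS OF SEVEN CORNERS**: the relation of a pattern with partner `j` is one of the five non-crossing perfect matchings of the
other six corners. [cite: KhristoforovSmirnov2021, §1.2 (arXiv v1 pp. 2–3: «disjoint paths, matching marked points»)] -/
theorem relation_seven {j : Fin 7} {L : Finset (Fin 7 × Fin 7)} (hP : IsPattern j L) : ∃ m : Fin 5, L = rel₇ j m := by
  -- bookkeeping in ℤ/7
  have others : ∀ j x : Fin 7, x ≠ j → x = j + 1 ∨ x = j + 2 ∨ x = j + 3 ∨ x = j + 4 ∨ x = j + 5 ∨ x = j + 6 := by decide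
  have dis : ∀ j : Fin 7, j + 1 ≠ j ∧ j + 2 ≠ j ∧ j + 3 ≠ j ∧ j + 4 ≠ j ∧ j + 5 ≠ j ∧ j + 6 ≠ j := by decide
  obtain ⟨n1, n2, n3, n4, n5, n6⟩ := dis j
  have Q : ∀ (a b c d : Fin 7), a < b → b < c → c < d → ∀ j : Fin 7, CcwQuad (j + a) (j + b) (j + c) (j + d) := by
    unfold CcwQuad; decide +kernel
  have q1234 := Q 1 2 3 4 (by decide) (by decide) (by decide) j
  have q1235 := Q 1 2 3 5 (by decide) (by decide) (by decide) j
  have q1236 := Q 1 2 3 6 (by decide) (by decide) (by decide) j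
  have q1256 := Q 1 2 5 6 (by decide) (by decide) (by decide) j
  have q1356 := Q 1 3 5 6 (by decide) (by decide) (by decide) j
  have q1456 := Q 1 4 5 6 (by decide) (by decide) (by decide) j
  have q3456 := Q 3 4 5 6 (by decide) (by decide) (by decide) j
  have q1245 := Q 1 2 4 5 (by decide) (by decide) (by decide) j
  have q1246 := Q 1 2 4 6 (by decide) (by decide) (by decide) j
  have q2345 := Q 2 3 4 5 (by decide) (by decide) (by decide) j
  have huniq : ∀ {a c d : Fin 7}, (a, c) ∈ L → (a, d) ∈ L → c = d := fun hc hd => hP.partner_eq hc hd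
  -- the partner of `j+1`
  obtain ⟨b, hb, -⟩ := hP.perfect (j + 1) n1
  have hbj : b ≠ j := hP.off₂ hb
  have hb' := hP.symm _ _ hb
  -- generic extensionality step: once three chords (with both orientations) lie in `L`, `L` IS that relation
  have ext_of : ∀ {a₁ b₁ a₂ b₂ a₃ b₃ : Fin 7}, (a₁, b₁) ∈ L → (a₂, b₂) ∈ L → (a₃, b₃) ∈ L →
      (∀ x : Fin 7, x ≠ j → x = a₁ ∨ x = b₁ ∨ x = a₂ ∨ x = b₂ ∨ x = a₃ ∨ x = b₃) →
      L = {(a₁, b₁), (b₁, a₁), (a₂, b₂), (b₂, a₂), (a₃, b₃), (b₃, a₃)} := by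
    intro a₁ b₁ a₂ b₂ a₃ b₃ h1 h2 h3 hcov
    have h1' := hP.symm _ _ h1
    have h2' := hP.symm _ _ h2
    have h3' := hP.symm _ _ h3
    ext ⟨x, y⟩
    simp only [Finset.mem_insert, Finset.mem_singleton, Prod.mk.injEq]
    constructor
    · intro hxy
      have hxj : x ≠ j := hP.off x y hxy
      rcases hcov x hxj with rfl | rfl | rfl | rfl | rfl | rfl
      · exact Or.inl ⟨rfl, huniq h1 hxy ▸ rfl⟩
      · exact Or.inr (Or.inl ⟨rfl, huniq h1' hxy ▸ rfl⟩)
      · exact Or.inr (Or.inr (Or.inl ⟨rfl, huniq h2 hxy ▸ rfl⟩))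
      · exact Or.inr (Or.inr (Or.inr (Or.inl ⟨rfl, huniq h2' hxy ▸ rfl⟩)))
      · exact Or.inr (Or.inr (Or.inr (Or.inr (Or.inl ⟨rfl, huniq h3 hxy ▸ rfl⟩))))
      · exact Or.inr (Or.inr (Or.inr (Or.inr (Or.inr ⟨rfl, huniq h3' hxy ▸ rfl⟩))))
    · rintro (⟨rfl, rfl⟩ | ⟨rfl, rfl⟩ | ⟨rfl, rfl⟩ | ⟨rfl, rfl⟩ | ⟨rfl, rfl⟩ | ⟨rfl, rfl⟩)
      · exact h1
      · exact h1'
      · exact h2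
      · exact h2'
      · exact h3
      · exact h3'
  -- the partner of a given other corner lies among the others and differs from known-matched ones
  have partner_in : ∀ {x y : Fin 7}, (x, y) ∈ L → y ≠ j ∧ y ≠ x := fun h => ⟨hP.off₂ h, fun e => hP.ne_of_mem h e.symm⟩
  -- exclusion: if `(s, p) ∈ L` then `(x, s) ∈ L` forces `x = p`
  have excl : ∀ {x s p : Fin 7}, (s, p) ∈ L → (x, s) ∈ L → x = p := fun hsp hxs => huniq (hP.symm _ _ hxs) hsp
  rcases others j b hbj with rfl | rfl | rfl | rfl | rfl | rfl
  · -- b = j+1: impossible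
    exact absurd rfl (hP.ne_of_mem hb)
  · -- j+1 ~ j+2
    obtain ⟨c, hc, -⟩ := hP.perfect (j + 3) n3
    obtain ⟨hcj, hc3⟩ := partner_in hc
    have hc' := hP.symm _ _ hc
    rcases others j c hcj with rfl | rfl | rfl | rfl | rfl | rfl
    · exact absurd (add_left_cancel (excl hb hc)) (by decide)   -- (j+3, j+1): partner of j+1 is j+2 ⇒ j+3 = j+2
    · exact absurd (add_left_cancel (excl hb' hc)) (by decide)
    · exact absurd rfl hc3
    · -- j+3 ~ j+4 ⇒ j+5 ~ j+6 : m = 0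
      obtain ⟨d, hd, -⟩ := hP.perfect (j + 5) n5
      obtain ⟨hdj, hd5⟩ := partner_in hd
      have hd6 : d = j + 6 := by
        rcases others j d hdj with rfl | rfl | rfl | rfl | rfl | rfl
        · exact absurd (add_left_cancel (excl hb hd)) (by decide)
        · exact absurd (add_left_cancel (excl hb' hd)) (by decide)
        · exact absurd (add_left_cancel (excl hc hd)) (by decide)
        · exact absurd (add_left_cancel (excl hc' hd)) (by decide)
        · exact absurd rfl hd5
        · rfl
      subst hd6
      refine ⟨0, ?_⟩
      rw [ext_of hb hc hd (fun x hx => ?_)]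
      · rfl
      · rcases others j x hx with h | h | h | h | h | h <;> simp [h]
    · -- j+3 ~ j+5: crossing with the partner of j+4
      exfalso
      obtain ⟨d, hd, -⟩ := hP.perfect (j + 4) n4
      obtain ⟨hdj, hd4⟩ := partner_in hd
      rcases others j d hdj with rfl | rfl | rfl | rfl | rfl | rfl
      · exact absurd (add_left_cancel (excl hb hd)) (by decide)
      · exact absurd (add_left_cancel (excl hb' hd)) (by decide)
      · exact absurd (add_left_cancel (excl hc hd)) (by decide)
      · exact absurd rfl hd4
      · exact absurd (add_left_cancel (excl hc' hd)) (by decide)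
      · exact hP.planar _ _ _ _ hc hd q3456
    · -- j+3 ~ j+6 ⇒ j+4 ~ j+5 : m = 1
      obtain ⟨d, hd, -⟩ := hP.perfect (j + 4) n4
      obtain ⟨hdj, hd4⟩ := partner_in hd
      have hd5 : d = j + 5 := by
        rcases others j d hdj with rfl | rfl | rfl | rfl | rfl | rfl
        · exact absurd (add_left_cancel (excl hb hd)) (by decide)
        · exact absurd (add_left_cancel (excl hb' hd)) (by decide)
        · exact absurd (add_left_cancel (excl hc hd)) (by decide)
        · exact absurd rfl hd4
        · rfl
        · exact absurd (add_left_cancel (excl hc' hd)) (by decide)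
      subst hd5
      refine ⟨1, ?_⟩
      rw [ext_of hb hc hd (fun x hx => ?_)]
      · rfl
      · rcases others j x hx with h | h | h | h | h | h <;> simp [h]
  · -- j+1 ~ j+3: crossing with the partner of j+2
    exfalso
    obtain ⟨c, hc, -⟩ := hP.perfect (j + 2) n2
    obtain ⟨hcj, hc2⟩ := partner_in hc
    rcases others j c hcj with rfl | rfl | rfl | rfl | rfl | rfl
    · exact absurd (add_left_cancel (excl hb hc)) (by decide)
    · exact absurd rfl hc2
    · exact absurd (add_left_cancel (excl hb' hc)) (by decide)
    · exact hP.planar _ _ _ _ hb hc q1234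
    · exact hP.planar _ _ _ _ hb hc q1235
    · exact hP.planar _ _ _ _ hb hc q1236
  · -- j+1 ~ j+4 ⇒ j+2 ~ j+3 and j+5 ~ j+6 : m = 2
    obtain ⟨c, hc, -⟩ := hP.perfect (j + 2) n2
    obtain ⟨hcj, hc2⟩ := partner_in hc
    have hc3 : c = j + 3 := by
      rcases others j c hcj with rfl | rfl | rfl | rfl | rfl | rfl
      · exact absurd (add_left_cancel (excl hb hc)) (by decide)
      · exact absurd rfl hc2
      · rfl
      · exact absurd (add_left_cancel (excl hb' hc)) (by decide)
      · exact absurd q1245 (hP.planar _ _ _ _ hb hc)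
      · exact absurd q1246 (hP.planar _ _ _ _ hb hc)
    subst hc3
    have hc' := hP.symm _ _ hc
    obtain ⟨d, hd, -⟩ := hP.perfect (j + 5) n5
    obtain ⟨hdj, hd5⟩ := partner_in hd
    have hd6 : d = j + 6 := by
      rcases others j d hdj with rfl | rfl | rfl | rfl | rfl | rfl
      · exact absurd (add_left_cancel (excl hb hd)) (by decide)
      · exact absurd (add_left_cancel (excl hc hd)) (by decide)
      · exact absurd (add_left_cancel (excl hc' hd)) (by decide)
      · exact absurd (add_left_cancel (excl hb' hd)) (by decide)
      · exact absurd rfl hd5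
      · rfl
    subst hd6
    refine ⟨2, ?_⟩
    rw [ext_of hb hc hd (fun x hx => ?_)]
    · rfl
    · rcases others j x hx with h | h | h | h | h | h <;> simp [h]
  · -- j+1 ~ j+5: crossing with the partner of j+6
    exfalso
    obtain ⟨c, hc, -⟩ := hP.perfect (j + 6) n6
    obtain ⟨hcj, hc6⟩ := partner_in hc
    have hc' := hP.symm _ _ hc
    rcases others j c hcj with rfl | rfl | rfl | rfl | rfl | rfl
    · exact absurd (add_left_cancel (excl hb hc)) (by decide)
    · exact hP.planar _ _ _ _ hb hc' q1256
    · exact hP.planar _ _ _ _ hb hc' q1356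
    · exact hP.planar _ _ _ _ hb hc' q1456
    · exact absurd (add_left_cancel (excl hb' hc)) (by decide)
    · exact absurd rfl hc6
  · -- j+1 ~ j+6
    obtain ⟨c, hc, -⟩ := hP.perfect (j + 2) n2
    obtain ⟨hcj, hc2⟩ := partner_in hc
    rcases others j c hcj with rfl | rfl | rfl | rfl | rfl | rfl
    · exact absurd (add_left_cancel (excl hb hc)) (by decide)
    · exact absurd rfl hc2
    · -- j+2 ~ j+3 ⇒ j+4 ~ j+5 : m = 3
      have hc' := hP.symm _ _ hc
      obtain ⟨d, hd, -⟩ := hP.perfect (j + 4) n4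
      obtain ⟨hdj, hd4⟩ := partner_in hd
      have hd5 : d = j + 5 := by
        rcases others j d hdj with rfl | rfl | rfl | rfl | rfl | rfl
        · exact absurd (add_left_cancel (excl hb hd)) (by decide)
        · exact absurd (add_left_cancel (excl hc hd)) (by decide)
        · exact absurd (add_left_cancel (excl hc' hd)) (by decide)
        · exact absurd rfl hd4
        · rfl
        · exact absurd (add_left_cancel (excl hb' hd)) (by decide)
      subst hd5
      refine ⟨3, ?_⟩
      rw [ext_of hb hc hd (fun x hx => ?_)]
      · rfl
      · rcases others j x hx with h | h | h | h | h | h <;> simp [h]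
    · -- j+2 ~ j+4: crossing with the partner of j+3
      exfalso
      have hc' := hP.symm _ _ hc
      obtain ⟨d, hd, -⟩ := hP.perfect (j + 3) n3
      obtain ⟨hdj, hd3⟩ := partner_in hd
      rcases others j d hdj with rfl | rfl | rfl | rfl | rfl | rfl
      · exact absurd (add_left_cancel (excl hb hd)) (by decide)
      · exact absurd (add_left_cancel (excl hc hd)) (by decide)
      · exact absurd rfl hd3
      · exact absurd (add_left_cancel (excl hc' hd)) (by decide)
      · exact hP.planar _ _ _ _ hc hd q2345
      · exact absurd (add_left_cancel (excl hb' hd)) (by decide)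
    · -- j+2 ~ j+5 ⇒ j+3 ~ j+4 : m = 4
      have hc' := hP.symm _ _ hc
      obtain ⟨d, hd, -⟩ := hP.perfect (j + 3) n3
      obtain ⟨hdj, hd3⟩ := partner_in hd
      have hd4 : d = j + 4 := by
        rcases others j d hdj with rfl | rfl | rfl | rfl | rfl | rfl
        · exact absurd (add_left_cancel (excl hb hd)) (by decide)
        · exact absurd (add_left_cancel (excl hc hd)) (by decide)
        · exact absurd rfl hd3
        · rfl
        · exact absurd (add_left_cancel (excl hc' hd)) (by decide)
        · exact absurd (add_left_cancel (excl hb' hd)) (by decide)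
      subst hd4
      refine ⟨4, ?_⟩
      rw [ext_of hb hc hd (fun x hx => ?_)]
      · rfl
      · rcases others j x hx with h | h | h | h | h | h <;> simp [h]
    · exact absurd (add_left_cancel (excl hb' hc)) (by decide)

/-- the depth table of the thirty-five patterns of seven corners: `(j; rel₇ j m)` is OUTERMOST (depth `0`) iff `j = 0`, or `j = 6`,
or `j = 2 ∧ m ∈ {0, 2}`, or `j = 4 ∧ m ∈ {0, 1}` — fourteen of them. [cite: KhristoforovSmirnov2021, §1.2 (arXiv v1 p. 2)] -/
theorem depth_seven (j : Fin 7) (m : Fin 5) :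
    depth j (rel₇ j m) = 0 ↔ j = 0 ∨ j = 6 ∨ (j = 2 ∧ (m = 0 ∨ m = 2)) ∨ (j = 4 ∧ (m = 0 ∨ m = 1)) := by
  revert j m; unfold depth rel₇; decide +kernel

/-- the partners of the fourteen outermost patterns … [cite: KhristoforovSmirnov2021, §1.2 (arXiv v1 p. 2)] -/
def outerJ₇ : Fin 14 → Fin 7 := ![0, 0, 0, 0, 0, 2, 2, 4, 4, 6, 6, 6, 6, 6]

/-- … and their matchings (index into `rel₇`). [cite: KhristoforovSmirnov2021, §1.2 (arXiv v1 p. 2)] -/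
def outerM₇ : Fin 14 → Fin 5 := ![0, 1, 2, 3, 4, 0, 2, 0, 1, 0, 1, 2, 3, 4]

/-- the fourteen outermost patterns have depth zero (table lookup). [cite: KhristoforovSmirnov2021, §1.2 (arXiv v1 p. 2)] -/
theorem depth_outer₇ (i : Fin 14) : depth (outerJ₇ i) (rel₇ (outerJ₇ i) (outerM₇ i)) = 0 := by
  revert i; unfold depth rel₇ outerJ₇ outerM₇; decide +kernel

/-- **the fourteen OUTERMOST patterns of seven corners.** [cite: KhristoforovSmirnov2021, §1.2 (arXiv v1 p. 2)] -/
def outer₇ (i : Fin 14) : Pat₀ 7 := ⟨⟨(outerJ₇ i, rel₇ (outerJ₇ i) (outerM₇ i)), isPattern_rel₇ _ _⟩, depth_outer₇ i⟩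

/-- `outer₇` is injective (the fourteen tabulated pairs are distinct). [cite: KhristoforovSmirnov2021, §1.2 (arXiv v1 p. 2)] -/
theorem outer₇_injective : Function.Injective outer₇ := by
  intro i i' h
  have h' : (outerJ₇ i, rel₇ (outerJ₇ i) (outerM₇ i)) = (outerJ₇ i', rel₇ (outerJ₇ i') (outerM₇ i')) :=
    congrArg (fun q : Pat₀ 7 => q.1.1) h
  have key : ∀ i i' : Fin 14,
      (outerJ₇ i, rel₇ (outerJ₇ i) (outerM₇ i)) = (outerJ₇ i', rel₇ (outerJ₇ i') (outerM₇ i')) → i = i' := by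
    unfold outerJ₇ outerM₇ rel₇; decide +kernel
  exact key i i' h'

/-- ★★ **THE OUTERMOST PATTERNS OF SEVEN CORNERS ARE EXACTLY FOURTEEN** (`= C₄`): every depth-`0` pattern is one of `outer₇ i`.
[cite: KhristoforovSmirnov2021, §1.2 (arXiv v1 p. 2)] -/
theorem pat₀_seven (q : Pat₀ 7) : ∃ i : Fin 14, q = outer₇ i := by
  obtain ⟨⟨⟨j, L⟩, hP⟩, h0⟩ := q
  have hP' : IsPattern j L := hP
  have h0' : depth j L = 0 := h0
  obtain ⟨m, rfl⟩ := relation_seven hP'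
  have key : ∀ (j : Fin 7) (m : Fin 5), depth j (rel₇ j m) = 0 →
      ∃ i : Fin 14, (j, rel₇ j m) = (outerJ₇ i, rel₇ (outerJ₇ i) (outerM₇ i)) := by
    intro j m h
    rcases (depth_seven j m).1 h with rfl | rfl | ⟨rfl, rfl | rfl⟩ | ⟨rfl, rfl | rfl⟩
    · fin_cases m
      · exact ⟨0, rfl⟩
      · exact ⟨1, rfl⟩
      · exact ⟨2, rfl⟩
      · exact ⟨3, rfl⟩
      · exact ⟨4, rfl⟩
    · fin_cases m
      · exact ⟨9, rfl⟩
      · exact ⟨10, rfl⟩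
      · exact ⟨11, rfl⟩
      · exact ⟨12, rfl⟩
      · exact ⟨13, rfl⟩
    · exact ⟨5, rfl⟩
    · exact ⟨6, rfl⟩
    · exact ⟨7, rfl⟩
    · exact ⟨8, rfl⟩
  obtain ⟨i, hi⟩ := key j m h0'
  exact ⟨i, Subtype.ext (Subtype.ext hi)⟩

/-- ★★ hence `#Pat₀ 7 = 14`. [cite: KhristoforovSmirnov2021, §1.2 (arXiv v1 p. 2)] -/
theorem card_pat₀_seven : Fintype.card (Pat₀ 7) = 14 := by
  have hbij : Function.Bijective outer₇ := ⟨outer₇_injective, fun q => by obtain ⟨i, hi⟩ := pat₀_seven q; exact ⟨i, hi.symm⟩⟩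
  rw [← Fintype.card_congr (Equiv.ofBijective outer₇ hbij), Fintype.card_fin]

/-- ★★★ **THE TRIPOD LAW AT SEVEN MARKS HAS A FOURTEEN-DIMENSIONAL SOLUTION SPACE** (the generic `finrank_solW` evaluated at `k = 7`).
[cite: KhristoforovSmirnov2021, §2 Lemma 4, proof and Fig. 3 (p. 4); §1.2 (p. 2)] -/
theorem finrank_solW_seven : Module.finrank ℂ (solW 7) = 14 := by
  rw [finrank_solW, card_pat₀_seven]

/-- ★ … and **there are exactly fourteen non-crossing perfect matchings of eight points** (the Catalan number `C₄`, via the tree's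
`pat₀EquivNCMatching`). [cite: KhristoforovSmirnov2021, §1.2 (arXiv v1 p. 2: link patterns)] -/
theorem card_ncMatching_eight : Fintype.card (NCMatching 8) = 14 := by
  rw [← card_pat₀_eq_card_ncMatching, card_pat₀_seven]

/-- ★ the number of ALL patterns of seven corners is `35 = 7 · C₃` … [cite: KhristoforovSmirnov2021, §1.2 (arXiv v1 p. 2)] -/
theorem card_pat_seven : Fintype.card (Pat 7) = 35 := by
  let f : Fin 7 × Fin 5 → Pat 7 := fun jm => ⟨(jm.1, rel₇ jm.1 jm.2), isPattern_rel₇ jm.1 jm.2⟩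
  have hinj : Function.Injective f := by
    rintro ⟨j, m⟩ ⟨j', m'⟩ h
    have h' : (j, rel₇ j m) = (j', rel₇ j' m') := congrArg (fun q : Pat 7 => q.1) h
    have key : ∀ (j : Fin 7) (m : Fin 5) (j' : Fin 7) (m' : Fin 5), (j, rel₇ j m) = (j', rel₇ j' m') → (j, m) = (j', m') := by
      unfold rel₇; decide +kernel
    exact key j m j' m' h'
  have hsurj : Function.Surjective f := by
    rintro ⟨⟨j, L⟩, hP⟩
    obtain ⟨m, rfl⟩ := relation_seven (show IsPattern j L from hP)
    exact ⟨(j, m), rfl⟩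
  rw [← Fintype.card_congr (Equiv.ofBijective f ⟨hinj, hsurj⟩), Fintype.card_prod, Fintype.card_fin, Fintype.card_fin]

/-- ★ … so the tripod pictures (`Pic 7`, the relations of the law) number `21 = 35 − 14`. [cite: KhristoforovSmirnov2021, §2 Lemma 4 (p. 4)] -/
theorem card_pic_seven : Fintype.card (Pic 7) = 21 := by
  have h := finrank_solW_add_card_pic 7
  rw [finrank_solW_seven, card_pat_seven] at h
  omega

end PatternsSeven

/-! ### Fourteen free outermost values: the law at seven marks solved -/
section SolvedSeven

/-- the fourteen outermost patterns as an equivalence `Fin 14 ≃ Pat₀ 7`. [cite: KhristoforovSmirnov2021, §1.2 (arXiv v1 p. 2)] -/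
noncomputable def outerEquiv₇ : Fin 14 ≃ Pat₀ 7 :=
  Equiv.ofBijective outer₇ ⟨outer₇_injective, fun q => by obtain ⟨i, hi⟩ := pat₀_seven q; exact ⟨i, hi.symm⟩⟩

/-- `outerEquiv₇ i = outer₇ i`. [cite: KhristoforovSmirnov2021, §1.2 (arXiv v1 p. 2)] -/
theorem outerEquiv₇_apply (i : Fin 14) : outerEquiv₇ i = outer₇ i := rfl

/-- ★★★ **FOURTEEN FREE VALUES**: a solution of the tripod law at seven marks is the same as its fourteen values at the outermost patterns
(restriction is a linear isomorphism `solW 7 ≃ₗ[ℂ] ℂ¹⁴`; the generic `solWEquiv` made explicit).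
[cite: KhristoforovSmirnov2021, §2 Lemma 4, proof and Fig. 3 (arXiv v1 p. 4); §1.2 (p. 2)] -/
noncomputable def solWEquiv₇ : solW 7 ≃ₗ[ℂ] (Fin 14 → ℂ) := (solWEquiv 7).trans (LinearEquiv.funCongrLeft ℂ ℂ outerEquiv₇)

/-- the isomorphism evaluated: the value at the `i`-th outermost pattern. [cite: KhristoforovSmirnov2021, §2 Lemma 4 (arXiv v1 p. 4)] -/
theorem solWEquiv₇_apply (w : solW 7) (i : Fin 14) : solWEquiv₇ w i = w.1 (outer₇ i).1 := rfl

/-- ★★ **A BASIS OF FOURTEEN CANONICAL SOLUTIONS** (`basisW` of the outermost patterns, indexed by `Fin 14`).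
[cite: KhristoforovSmirnov2021, §2 Definition 3 and Lemma 4 (arXiv v1 p. 4)] -/
noncomputable def basis₇ : Module.Basis (Fin 14) ℂ (solW 7) := (solWBasis 7).reindex outerEquiv₇.symm

/-- the basis vectors are the canonical solutions `basisW (outer₇ i)`. [cite: KhristoforovSmirnov2021, §2 Lemma 4 (arXiv v1 p. 4)] -/
theorem coe_basis₇ (i : Fin 14) : ((basis₇ i : solW 7) : Pat 7 → ℂ) = basisW (outer₇ i) := by
  rw [basis₇, Module.Basis.reindex_apply, Equiv.symm_symm, outerEquiv₇_apply, coe_solWBasis]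

/-- ★★★ **THE TRIPOD LAW AT SEVEN MARKS, SOLVED**: a seven-disorder class weight obeys the tripod law iff its restriction to the thirty-five
patterns is a linear combination of the fourteen canonical solutions — the coefficients being its values at the fourteen outermost patterns.
[cite: KhristoforovSmirnov2021, §2 Definition 3 and Lemma 4 (arXiv v1 p. 4); §1.2 (p. 2)] -/
theorem tripodLaw_seven_iff_exists_sum_basisW (wt : Fin 7 → Finset (Fin 7 × Fin 7) → ℂ) :
    TripodLaw wt ↔ ∃ g : Fin 14 → ℂ, restrictW wt = ∑ i : Fin 14, g i • basisW (outer₇ i) := by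
  rw [tripodLaw_iff_restrict_mem_solW]
  constructor
  · intro h
    refine ⟨fun i => restrictW wt (outer₇ i).1, ?_⟩
    calc restrictW wt = ∑ q : Pat₀ 7, restrictW wt q.1 • basisW q := eq_sum_basisW_of_mem_solW h
      _ = ∑ i : Fin 14, restrictW wt (outerEquiv₇ i).1 • basisW (outerEquiv₇ i) :=
          (Equiv.sum_comp outerEquiv₇ (fun q : Pat₀ 7 => restrictW wt q.1 • basisW q)).symm
      _ = _ := rfl
  · rintro ⟨g, hg⟩
    rw [hg]
    exact Submodule.sum_mem _ fun i _ => Submodule.smul_mem _ _ (basisW_mem_solW _)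

/-- ★ … in particular the values at the fourteen outermost patterns may be prescribed ARBITRARILY (and determine the solution).
[cite: KhristoforovSmirnov2021, §2 Lemma 4 (arXiv v1 p. 4)] -/
theorem exists_unique_solW_seven (φ : Fin 14 → ℂ) : ∃! w : solW 7, ∀ i : Fin 14, w.1 (outer₇ i).1 = φ i := by
  refine ⟨solWEquiv₇.symm φ, fun i => ?_, fun w hw => ?_⟩
  · have := congrFun (solWEquiv₇.apply_symm_apply φ) i
    rwa [solWEquiv₇_apply] at this
  · apply solWEquiv₇.injective
    rw [LinearEquiv.apply_symm_apply]
    funext i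
    rw [solWEquiv₇_apply, hw i]

end SolvedSeven

/-! ### The seven rotated fans: independent, but only half of the solutions -/
section SevenFans

/-- `1 + τ + τ² = 0`. [folklore] -/
private theorem tau_sum₇' : 1 + tau + tau ^ 2 = 0 := by
  have hprim : IsPrimitiveRoot tau 3 := by
    have h := Complex.isPrimitiveRoot_exp 3 (by norm_num)
    unfold tau
    convert h using 2
    push_cast
    ring
  have h := hprim.geom_sum_eq_zero (by norm_num : 1 < 3)
  simp only [Finset.sum_range_succ, Finset.sum_range_zero, pow_zero, pow_one, zero_add] at h
  linear_combination h

/-- `τ ≠ 0`. [folklore] -/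
private theorem tau_ne_zero₇' : tau ≠ 0 := fun h => by
  have h3 : tau ^ 3 = 1 := by linear_combination (tau - 1) * tau_sum₇'
  rw [h] at h3
  norm_num at h3

/-- powers of the rotation act by addition: `rot^s x = x + s` (seven corners).
[cite: KhristoforovSmirnov2021, §1.2 (arXiv v1 p. 2: cyclic indexing)] -/
theorem rot_pow_apply_seven (s x : Fin 7) : (rot 7 ^ s.val) x = x + s := by
  apply Fin.ext
  rw [val_rot_pow, Fin.val_add]

/-- the image of a relation under a power of the rotation is its translate (seven corners). [cite: KhristoforovSmirnov2021, §1.2 (arXiv v1 p. 2)] -/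
theorem relMap_rot_pow_seven (s : Fin 7) (L : Finset (Fin 7 × Fin 7)) :
    relMap (rot 7 ^ s.val) L = L.image fun ab => (ab.1 + s, ab.2 + s) := by
  unfold relMap
  rw [Finset.map_eq_image]
  refine Finset.image_congr fun ab _ => ?_
  show ((rot 7 ^ s.val) ab.1, (rot 7 ^ s.val) ab.2) = (ab.1 + s, ab.2 + s)
  rw [rot_pow_apply_seven, rot_pow_apply_seven]

/-- translating `rel₇ j m` by `s` gives `rel₇ (j + s) m` (the five matchings are named by offsets from the partner).
[cite: KhristoforovSmirnov2021, §1.2 (arXiv v1 p. 2: cyclic indexing)] -/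
theorem rel₇_translate (j s : Fin 7) (m : Fin 5) : (rel₇ j m).image (fun ab => (ab.1 + s, ab.2 + s)) = rel₇ (j + s) m := by
  revert j s m; unfold rel₇; decide +kernel

/-- the pattern `(j; rel₇ j m)` as an element of `Pat 7`. [cite: KhristoforovSmirnov2021, §1.2 (arXiv v1 p. 2)] -/
def pat₇ (j : Fin 7) (m : Fin 5) : Pat 7 := ⟨(j, rel₇ j m), isPattern_rel₇ j m⟩

/-- **the support of the fan weight at seven corners**: the fan with apex `0, 1, 2, 3` is the pattern `(0; {16,25,34})`, `(1; {14,23,56})`,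
`(2; {12,36,45})`, `(3; {16,25,34})` respectively (offsets from the apex), i.e. the `(j, m)` pairs `(0,4), (1,2), (2,1), (3,4)`.
[cite: KhristoforovSmirnov2021, §2 Definition 3 (arXiv v1 p. 4)] -/
def fanSupport₇ : Finset (Fin 7 × Fin 5) := {((0 : Fin 7), (4 : Fin 5)), (1, 2), (2, 1), (3, 4)}

/-- ★ the fan weight of `MarkedLoopHolomorphy` (`l = 3`) on the thirty-five patterns: `−(−τ²)^j` on its four support patterns, else `0`.
[cite: KhristoforovSmirnov2021, §2 Definition 3 (arXiv v1 p. 4)] -/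
theorem fanWt_three_rel₇ (j : Fin 7) (m : Fin 5) :
    fanWt 3 j (rel₇ j m) = if (j, m) ∈ fanSupport₇ then -((-tau ^ 2) ^ j.val) else 0 := by
  have key : ∀ (j : Fin 7) (m : Fin 5), (j.val ≤ 3 ∧ rel₇ j m = fanRel 3 j.val) ↔ (j, m) ∈ fanSupport₇ := by
    unfold rel₇ fanRel fanSupport₇; decide +kernel
  unfold fanWt
  by_cases h : j.val ≤ 3 ∧ rel₇ j m = fanRel 3 j.val
  · rw [if_pos h, if_pos ((key j m).1 h)]
  · rw [if_neg h, if_neg (fun h' => h ((key j m).2 h'))]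

/-- **the `s`-th ROTATED FAN at seven corners** (marks relabelled by `rot^s`), restricted to the patterns.
[cite: KhristoforovSmirnov2021, §2 Definition 3 (arXiv v1 p. 4); Remark 6 (p. 5)] -/
noncomputable def fanR₇ (s : Fin 7) : Pat 7 → ℂ := restrictW (rotW (rot 7 ^ s.val) (fanWt 3))

/-- each rotated fan solves the tripod law. [cite: KhristoforovSmirnov2021, §2 Lemma 4 (arXiv v1 p. 4); Remark 6 (p. 5)] -/
theorem fanR₇_mem_solW (s : Fin 7) : fanR₇ s ∈ solW 7 :=
  tripodLaw_iff_restrict_mem_solW.1 (tripodLaw_rotW_fanWt 3 s.val)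

/-- ★ **the rotated fans on the patterns**: `fanR₇ s (t; rel₇ t m)` is `−(−τ²)^(t+s)` if `(t + s, m)` lies in the support, else `0`.
[cite: KhristoforovSmirnov2021, §2 Definition 3 (arXiv v1 p. 4); Remark 6 (p. 5)] -/
theorem fanR₇_pat₇ (s t : Fin 7) (m : Fin 5) :
    fanR₇ s (pat₇ t m) = if (t + s, m) ∈ fanSupport₇ then -((-tau ^ 2) ^ (t + s).val) else 0 := by
  unfold fanR₇ restrictW rotW pat₇
  show fanWt 3 ((rot 7 ^ s.val) t) (relMap (rot 7 ^ s.val) (rel₇ t m)) = _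
  rw [rot_pow_apply_seven, relMap_rot_pow_seven, rel₇_translate, fanWt_three_rel₇]

/-- ★★ **THE SEVEN ROTATED FANS ARE LINEARLY INDEPENDENT** (read them on the patterns `(t; {14,23,56})`, which carry exactly one fan each).
[cite: KhristoforovSmirnov2021, §2 Definition 3 and Lemma 4 (arXiv v1 p. 4); Remark 6 (p. 5)] -/
theorem linearIndependent_fanR₇ : LinearIndependent ℂ (fun s : Fin 7 => (⟨fanR₇ s, fanR₇_mem_solW s⟩ : solW 7)) := by
  rw [Fintype.linearIndependent_iff]
  intro g hg s₀
  have h := congrArg (fun w : solW 7 => (w : Pat 7 → ℂ) (pat₇ (1 - s₀) 2)) hg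
  simp only [Submodule.coe_sum, Submodule.coe_smul, Finset.sum_apply, Pi.smul_apply, smul_eq_mul,
    Submodule.coe_zero, Pi.zero_apply] at h
  have hone : ∀ s : Fin 7, ((1 - s₀ + s, (2 : Fin 5)) ∈ fanSupport₇ ↔ s = s₀) := by
    have : ∀ s₀ s : Fin 7, ((1 - s₀ + s, (2 : Fin 5)) ∈ fanSupport₇ ↔ s = s₀) := by unfold fanSupport₇; decide
    exact this s₀
  rw [Finset.sum_eq_single s₀] at h
  · rw [fanR₇_pat₇, if_pos ((hone s₀).2 rfl), show (1 - s₀ + s₀ : Fin 7) = 1 from by abel] at h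
    have : g s₀ * tau ^ 2 = 0 := by
      have e : ((1 : Fin 7).val) = 1 := rfl
      rw [e] at h
      linear_combination h
    exact (mul_eq_zero.1 this).resolve_right (pow_ne_zero _ tau_ne_zero₇')
  · intro s _ hs
    rw [fanR₇_pat₇, if_neg (fun hm => hs ((hone s).1 hm)), mul_zero]
  · intro h0; exact absurd (Finset.mem_univ _) h0

/-- ★★ … BUT THEY SPAN ONLY HALF OF THE SOLUTIONS: their span has dimension `7`, the solution space `14` — at seven marks the
tripod law has solutions that are not combinations of rotated fans (contrast: `fanBasis` at five marks).
[cite: KhristoforovSmirnov2021, §2 Lemma 4 (arXiv v1 p. 4); Remark 6 (p. 5)] -/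
theorem finrank_span_fanR₇ :
    Module.finrank ℂ (Submodule.span ℂ (Set.range fun s : Fin 7 => (⟨fanR₇ s, fanR₇_mem_solW s⟩ : solW 7))) = 7 := by
  rw [finrank_span_eq_card linearIndependent_fanR₇, Fintype.card_fin]

/-- ★★ the span of the seven rotated fans is a PROPER subspace of `solW 7`.
[cite: KhristoforovSmirnov2021, §2 Lemma 4 (arXiv v1 p. 4); Remark 6 (p. 5)] -/
theorem span_fanR₇_ne_top : Submodule.span ℂ (Set.range fun s : Fin 7 => (⟨fanR₇ s, fanR₇_mem_solW s⟩ : solW 7)) ≠ ⊤ := by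
  intro h
  have e := finrank_span_fanR₇
  rw [h, finrank_top, finrank_solW_seven] at e
  norm_num at e

end SevenFans

end Literature.Probability.Percolation.MarkedLoops
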